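import Summits.Ventures.CertifiedManyBodySolver.Downfold.OneBandInPlaneFermiPoints
import HarnessLib

/-!
# The direct one-band in-plane band, V: the `t–t′` contour through the nodal and antinodal Fermi points —
# velocity-matched nearest-neighbour scales `t_node`, `t_an` and the `t–t′` FORM DEFECT

Venture CertifiedManyBodySolver, cell `pub/hubbard-downfold` (stage S1, technique B; INFL-3to1-B), seat hubbard-downfold-mod-4;
namespace `Summit.Ventures.CertifiedManyBodySolver.Downfold.Emery`. Everything PROVED; no number lives here. WHAT THIS IS NOT:
a statement about any material; `U = 0` one-body kinematics.

The S2 solvers of the venture live on the `t–t′` one-band form (`EmeryBlochBand.oneBand`, dictionary D0). Given a nodal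
Fermi point `(k_n, k_n)` and an antinodal one `(π, k_a)` of a band, there is EXACTLY ONE shape `ρ = t′/t` whose `t–t′`
contour passes through both (`ttpRho`, `ttpRho_contour`, `ttpRho_unique`; `u = cos k_n`, `v = cos k_a`):
`ρ = −(1 − v + 2u) / (2(u² + v))`. On that contour the `t–t′` model with nearest-neighbour hopping `t₁` has squared
Fermi velocity `t₁²·ttpGradSqUV ρ` (`ttpGradSq_eq`). Hence three certified, division-free comparisons with the band's
own squared velocities (`ipGradSq` of `OneBandInPlane`), checked by the tree's kd-tree verifier on the bracket box
`[ua, ub] × [va, vb]` of `OneBandInPlaneFermiPoints` (eight claim terms `fcRhoD … fcDefect`, one kd certificate each —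
kept separate so each kernel check stays small; soundness `ipForm_of_checks`):

* the NODE-MATCHED scale `t_node ∈ [tn_lo, tn_hi]` (`t₁² · ttpGradSqUV ρ u u = |∇ε|²(k_n, k_n)`),
* the ANTINODE-MATCHED scale `t_an ∈ [ta_lo, ta_hi]` (`t₁² · ttpGradSqUV ρ (−1) v = |∇ε|²(π, k_a)`),
* the FORM DEFECT `δ`: `(v_an/v_node)²` of the `t–t′` contour is at least `(1 + δ)²` times the band's own — no single
  `(t, t′)` reproduces both Fermi velocities of the band better than the factor `1 + δ` (`= t_node/t_an`).

Sources: `t–t′(–t″)` form [AndersenEtAl1995, §6]; interval/subdivision verification [Moore1966, Theorem 3.1, §4.4].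
-/

noncomputable section

namespace Summit.Ventures.CertifiedManyBodySolver.Downfold.Emery

open Real Set Literature.Analysis.ValidatedNumerics

/-! ## §1 The `t–t′` reference (`t = 1`, shape `ρ = t′/t`) -/

/-- The `t–t′` band with `t = 1`, `t′ = ρ` in the cosines: `−2(u + v) − 4ρuv`. [cite: AndersenEtAl1995, §6] -/
def ttpUV (ρ u v : ℝ) : ℝ := -2 * (u + v) - 4 * ρ * (u * v)

/-- Dictionary: `ttpUV ρ (cos kx) (cos ky) = oneBand 0 1 ρ 0 kx ky`. [cite: AndersenEtAl1995, §6] -/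
theorem ttpUV_eq_oneBand (ρ kx ky : ℝ) : ttpUV ρ (cos kx) (cos ky) = oneBand 0 1 ρ 0 kx ky := by
  unfold ttpUV oneBand; ring

/-- A `t–t′` band with nearest-neighbour hopping `t₁` is `t₁` times the `t = 1` band. [folklore] -/
theorem oneBand_scale (t₁ ρ kx ky : ℝ) : oneBand 0 t₁ (t₁ * ρ) 0 kx ky = t₁ * oneBand 0 1 ρ 0 kx ky := by
  unfold oneBand; ring

/-- Squared Fermi velocity form factor of the `t = 1` `t–t′` band: `(1 − u²)(2 + 4ρv)² + (1 − v²)(2 + 4ρu)²`. [folklore] -/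
def ttpGradSqUV (ρ u v : ℝ) : ℝ := (1 - u ^ 2) * (2 + 4 * ρ * v) ^ 2 + (1 - v ^ 2) * (2 + 4 * ρ * u) ^ 2

/-- `∂/∂kx oneBand 0 1 ρ 0 = sin kx · (2 + 4ρ cos ky)`. [folklore] -/
theorem hasDerivAt_ttp_kx (ρ kx ky : ℝ) :
    HasDerivAt (fun kx => oneBand 0 1 ρ 0 kx ky) (sin kx * (2 + 4 * ρ * cos ky)) kx := by
  have hf : (fun kx => oneBand 0 1 ρ 0 kx ky) = fun kx => ttpUV ρ (cos kx) (cos ky) := by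
    funext k; rw [ttpUV_eq_oneBand]
  rw [hf]; unfold ttpUV
  have h := (((hasDerivAt_cos kx).add_const (cos ky)).const_mul (-2)).sub
    (((hasDerivAt_cos kx).mul_const (cos ky)).const_mul (4 * ρ))
  exact h.congr_deriv (by ring)

/-- `∂/∂ky oneBand 0 1 ρ 0 = sin ky · (2 + 4ρ cos kx)`. [folklore] -/
theorem hasDerivAt_ttp_ky (ρ kx ky : ℝ) :
    HasDerivAt (fun ky => oneBand 0 1 ρ 0 kx ky) (sin ky * (2 + 4 * ρ * cos kx)) ky := by
  have hf : (fun ky => oneBand 0 1 ρ 0 kx ky) = fun ky => ttpUV ρ (cos kx) (cos ky) := by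
    funext k; rw [ttpUV_eq_oneBand]
  rw [hf]; unfold ttpUV
  have h := (((hasDerivAt_cos ky).const_add (cos kx)).const_mul (-2)).sub
    (((hasDerivAt_cos ky).const_mul (cos kx)).const_mul (4 * ρ))
  exact h.congr_deriv (by ring)

/-- `|∇ oneBand 0 1 ρ 0|² = ttpGradSqUV ρ (cos kx) (cos ky)` (so `t₁²·ttpGradSqUV` for hopping `t₁`, by `oneBand_scale`). [folklore] -/
theorem ttpGradSq_eq (ρ kx ky : ℝ) :
    (sin kx * (2 + 4 * ρ * cos ky)) ^ 2 + (sin ky * (2 + 4 * ρ * cos kx)) ^ 2 = ttpGradSqUV ρ (cos kx) (cos ky) := by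
  unfold ttpGradSqUV; rw [mul_pow, mul_pow, sin_sq, sin_sq]

/-! ## §2 The unique `t–t′` contour through a diagonal point and a face point -/

/-- Numerator `−(1 − v + 2u)` of the osculating shape. [folklore] -/
def rhoN (u v : ℝ) : ℝ := -(1 - v + 2 * u)

/-- Denominator `2(u² + v)` of the osculating shape. [folklore] -/
def rhoD (u v : ℝ) : ℝ := 2 * (u ^ 2 + v)

/-- **The shape `ρ = t′/t` of the `t–t′` contour through the diagonal point `(u, u)` and the face point `(−1, v)`.** [folklore] -/
def ttpRho (u v : ℝ) : ℝ := rhoN u v / rhoD u v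

/-- The contour of shape `ttpRho u v` passes through both points. [folklore] -/
theorem ttpRho_contour {u v : ℝ} (h : rhoD u v ≠ 0) : ttpUV (ttpRho u v) u u = ttpUV (ttpRho u v) (-1) v := by
  have h' : u ^ 2 + v ≠ 0 := by unfold rhoD at h; intro h0; exact h (by rw [h0, mul_zero])
  unfold ttpRho ttpUV rhoD rhoN
  field_simp
  ring

/-- Uniqueness: any shape whose contour passes through both points is `ttpRho u v`. [folklore] -/
theorem ttpRho_unique {u v ρ : ℝ} (h : rhoD u v ≠ 0) (hρ : ttpUV ρ u u = ttpUV ρ (-1) v) : ρ = ttpRho u v := by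
  unfold ttpRho
  rw [eq_div_iff h]
  unfold ttpUV at hρ; unfold rhoD rhoN
  unfold rhoD at h
  linarith

/-- Division-free node form factor: `ttpGradSqUV ρ u u · rhoD² = 2(1 − u²)(2·rhoD + 4·rhoN·u)²`. [folklore] -/
def nodeFormN (u v : ℝ) : ℝ := 2 * (1 - u ^ 2) * (2 * rhoD u v + 4 * rhoN u v * u) ^ 2

/-- Division-free face form factor: `ttpGradSqUV ρ (−1) v · rhoD² = (1 − v²)(2·rhoD − 4·rhoN)²`. [folklore] -/
def faceFormN (u v : ℝ) : ℝ := (1 - v ^ 2) * (2 * rhoD u v - 4 * rhoN u v) ^ 2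

/-- [folklore] -/
theorem nodeFormN_eq {u v : ℝ} (h : rhoD u v ≠ 0) : ttpGradSqUV (ttpRho u v) u u * rhoD u v ^ 2 = nodeFormN u v := by
  unfold nodeFormN ttpGradSqUV ttpRho
  field_simp
  ring

/-- [folklore] -/
theorem faceFormN_eq {u v : ℝ} (h : rhoD u v ≠ 0) :
    ttpGradSqUV (ttpRho u v) (-1) v * rhoD u v ^ 2 = faceFormN u v := by
  unfold faceFormN ttpGradSqUV ttpRho
  field_simp
  ring

/-! ## §3 The certified comparison on the bracket box `[ua, ub] × [va, vb]` (`x 0 = u`, `x 1 = v`) -/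

/-- `rhoD` as an `ArithExpr`. [folklore] -/
def rhoDE : ArithExpr := .mul (.const 2) (.add (.mul (.var 0) (.var 0)) (.var 1))
/-- `rhoN` as an `ArithExpr`. [folklore] -/
def rhoNE : ArithExpr := .neg (.add (.sub (.const 1) (.var 1)) (.mul (.const 2) (.var 0)))
/-- `nodeFormN` as an `ArithExpr`. [folklore] -/
def nodeFormNE : ArithExpr :=
  let a : ArithExpr := .add (.mul (.const 2) rhoDE) (.mul (.mul (.const 4) rhoNE) (.var 0))
  .mul (.mul (.const 2) (.sub (.const 1) (.mul (.var 0) (.var 0)))) (.mul a a)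
/-- `faceFormN` as an `ArithExpr`. [folklore] -/
def faceFormNE : ArithExpr :=
  let a : ArithExpr := .sub (.mul (.const 2) rhoDE) (.mul (.const 4) rhoNE)
  .mul (.sub (.const 1) (.mul (.var 1) (.var 1))) (.mul a a)
/-- The band's squared velocity on the face in the variable `x 1 = v`. [folklore] -/
def ipFaceGradSqE₁ (S : List (ℕ × ℕ × ℚ)) : ArithExpr :=
  .mul (.sub (.const 1) (.mul (.var 1) (.var 1)))
    (.mul (ipBandUGE S (.var 1) (.const (-1))) (ipBandUGE S (.var 1) (.const (-1))))

/-- [folklore] -/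
@[simp] theorem eval_rhoDE (x : ℕ → ℝ) : rhoDE.eval x = rhoD (x 0) (x 1) := by simp [rhoDE, rhoD]; ring
/-- [folklore] -/
@[simp] theorem eval_rhoNE (x : ℕ → ℝ) : rhoNE.eval x = rhoN (x 0) (x 1) := by simp [rhoNE, rhoN]
/-- [folklore] -/
@[simp] theorem eval_nodeFormNE (x : ℕ → ℝ) : nodeFormNE.eval x = nodeFormN (x 0) (x 1) := by
  simp [nodeFormNE, nodeFormN]; ring
/-- [folklore] -/
@[simp] theorem eval_faceFormNE (x : ℕ → ℝ) : faceFormNE.eval x = faceFormN (x 0) (x 1) := by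
  simp [faceFormNE, faceFormN]; ring
/-- [folklore] -/
@[simp] theorem eval_ipFaceGradSqE₁ (S : List (ℕ × ℕ × ℚ)) (x : ℕ → ℝ) :
    (ipFaceGradSqE₁ S).eval x = ipGradSqUV S (-1) (x 1) := by
  simp [ipFaceGradSqE₁, eval_ipBandUGE, ipGradSqUV_face]; ring

/-- The 2-variable point of the kd verifier. [folklore] -/
def pt₂ (u v : ℝ) : ℕ → ℝ := fun i => if i = 0 then u else if i = 1 then v else 0

/-- [folklore] -/
@[simp] theorem pt₂_zero (u v : ℝ) : pt₂ u v 0 = u := rfl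
/-- [folklore] -/
@[simp] theorem pt₂_one (u v : ℝ) : pt₂ u v 1 = v := rfl

/-- kd box claim at the point `pt₂ u v`. [cite: Moore1966, Theorem 3.1, §4.4] -/
theorem eval_pt₂_le_of_kdCheck {e : ArithExpr} {b ulo uhi vlo vhi : ℚ} {t : KdCert ℕ}
    (h : t.check (exprLeOn e b) [(ulo, uhi), (vlo, vhi)] = true) {u v : ℝ}
    (hu : u ∈ Icc (ulo : ℝ) uhi) (hv : v ∈ Icc (vlo : ℝ) vhi) : e.eval (pt₂ u v) ≤ b :=
  eval_le_of_kdCheck₂ h hu hv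

/-- Claim term: `η − rhoD` (positivity margin of the shape denominator). [folklore] -/
def fcRhoD (η : ℚ) : ArithExpr := .sub (.const η) rhoDE
/-- Claim term: `η − nodeFormN`. [folklore] -/
def fcNodePos (η : ℚ) : ArithExpr := .sub (.const η) nodeFormNE
/-- Claim term: `η − faceFormN`. [folklore] -/
def fcFacePos (η : ℚ) : ArithExpr := .sub (.const η) faceFormNE
/-- Claim term: `tn_lo²·nodeFormN − rhoD²·V_n²`. [folklore] -/
def fcNodeLo (S : List (ℕ × ℕ × ℚ)) (tnlo : ℚ) : ArithExpr :=
  .sub (.mul (.const (tnlo ^ 2)) nodeFormNE) (.mul (.mul rhoDE rhoDE) (ipNodeGradSqE S))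
/-- Claim term: `rhoD²·V_n² − tn_hi²·nodeFormN`. [folklore] -/
def fcNodeHi (S : List (ℕ × ℕ × ℚ)) (tnhi : ℚ) : ArithExpr :=
  .sub (.mul (.mul rhoDE rhoDE) (ipNodeGradSqE S)) (.mul (.const (tnhi ^ 2)) nodeFormNE)
/-- Claim term: `ta_lo²·faceFormN − rhoD²·V_a²`. [folklore] -/
def fcFaceLo (S : List (ℕ × ℕ × ℚ)) (talo : ℚ) : ArithExpr :=
  .sub (.mul (.const (talo ^ 2)) faceFormNE) (.mul (.mul rhoDE rhoDE) (ipFaceGradSqE₁ S))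
/-- Claim term: `rhoD²·V_a² − ta_hi²·faceFormN`. [folklore] -/
def fcFaceHi (S : List (ℕ × ℕ × ℚ)) (tahi : ℚ) : ArithExpr :=
  .sub (.mul (.mul rhoDE rhoDE) (ipFaceGradSqE₁ S)) (.mul (.const (tahi ^ 2)) faceFormNE)
/-- Claim term: `(1+δ)²·nodeFormN·V_a² − faceFormN·V_n²`. [folklore] -/
def fcDefect (S : List (ℕ × ℕ × ℚ)) (δ : ℚ) : ArithExpr :=
  .sub (.mul (.mul (.const ((1 + δ) ^ 2)) nodeFormNE) (ipFaceGradSqE₁ S)) (.mul faceFormNE (ipNodeGradSqE S))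

/-- Sign conditions of the form check. [folklore] -/
def formSignCheck (tnlo tnhi talo tahi δ η : ℚ) : Bool :=
  decide (0 < η) && decide (0 ≤ tnlo) && decide (0 ≤ tnhi) && decide (0 ≤ talo) && decide (0 ≤ tahi) && decide (0 ≤ 1 + δ)

/-- `a² ≤ b²`, `0 ≤ a`, `0 ≤ b` ⇒ `a ≤ b`. [folklore] -/
theorem le_of_sq_le_sq' {a b : ℝ} (h : a ^ 2 ≤ b ^ 2) (ha : 0 ≤ a) (hb : 0 ≤ b) : a ≤ b := by
  have := sq_le_sq.1 h
  rwa [abs_of_nonneg ha, abs_of_nonneg hb] at this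

/-- **THE FORM THEOREM.** Shell list with monotonicity certificate, Fermi bracket of the filling window, node and face
brackets, the sign check and the eight passing claim certificates: for every Fermi energy `ε` with `ipFilling S ε ∈ [ν₁, ν₂]`, every nodal Fermi
momentum `k_n` (`ε(k_n, k_n) = ε`) and every antinodal one `k_a` (`ε(π, k_a) = ε`), with `u = cos k_n`, `v = cos k_a`,
`ρ = ttpRho u v`:
(i) the `t–t′` band of shape `ρ` takes the same value at `(k_n, k_n)` and `(π, k_a)` (one contour through both points);
(ii) NODE-MATCHED SCALE: every `t₁ ≥ 0` with `t₁²·ttpGradSqUV ρ u u = |∇ε|²(k_n, k_n)` lies in `[tn_lo, tn_hi]`;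
(iii) ANTINODE-MATCHED SCALE: every `t₁ ≥ 0` with `t₁²·ttpGradSqUV ρ (−1) v = |∇ε|²(π, k_a)` lies in `[ta_lo, ta_hi]`;
(iv) FORM DEFECT: `ttpGradSqUV ρ (−1) v · |∇ε|²(k_n, k_n) ≥ (1 + δ)² · ttpGradSqUV ρ u u · |∇ε|²(π, k_a)` — the `t–t′`
contour's antinode/node velocity ratio exceeds the band's by the factor `1 + δ` at least. [folklore] -/
theorem ipForm_of_checks {K : ℕ} (hK : 0 < K) {xl xh : ℕ → ℚ} (hG : GridEncl K xl xh)
    {S : List (ℕ × ℕ × ℚ)} (hS : shellsOK S = true) {tm : KdCert ℕ} (hm : ipMonoKdCheck S tm = true)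
    {e₁ e₂ ν₁ ν₂ ua ub va vb tnlo tnhi talo tahi δ η : ℚ} {jout jin : List ℕ} {t0 t1 t2 t3 t4 t5 t6 t7 : KdCert ℕ}
    (hbr : ipBracketCheckG K xl xh S e₁ e₂ ν₁ ν₂ jout jin = true)
    (hnb : ipNodeBracketCheck S e₁ e₂ ua ub = true) (hfb : ipFaceBracketCheck S e₁ e₂ va vb = true)
    (hsg : formSignCheck tnlo tnhi talo tahi δ η = true)
    (h0 : t0.check (exprLeOn (fcRhoD η) 0) [(ua, ub), (va, vb)] = true)
    (h1 : t1.check (exprLeOn (fcNodePos η) 0) [(ua, ub), (va, vb)] = true)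
    (h2 : t2.check (exprLeOn (fcFacePos η) 0) [(ua, ub), (va, vb)] = true)
    (h3 : t3.check (exprLeOn (fcNodeLo S tnlo) 0) [(ua, ub), (va, vb)] = true)
    (h4 : t4.check (exprLeOn (fcNodeHi S tnhi) 0) [(ua, ub), (va, vb)] = true)
    (h5 : t5.check (exprLeOn (fcFaceLo S talo) 0) [(ua, ub), (va, vb)] = true)
    (h6 : t6.check (exprLeOn (fcFaceHi S tahi) 0) [(ua, ub), (va, vb)] = true)
    (h7 : t7.check (exprLeOn (fcDefect S δ) 0) [(ua, ub), (va, vb)] = true)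
    {ε : ℝ} (hν : ipFilling S ε ∈ Icc (ν₁ : ℝ) ν₂) {kn ka : ℝ} (hn : ipBandK S kn kn = ε) (ha : ipBandK S π ka = ε) :
    oneBand 0 1 (ttpRho (cos kn) (cos ka)) 0 kn kn = oneBand 0 1 (ttpRho (cos kn) (cos ka)) 0 π ka ∧
    (∀ t : ℝ, 0 ≤ t → t ^ 2 * ttpGradSqUV (ttpRho (cos kn) (cos ka)) (cos kn) (cos kn) = ipGradSq S kn kn →
      t ∈ Icc (tnlo : ℝ) tnhi) ∧
    (∀ t : ℝ, 0 ≤ t → t ^ 2 * ttpGradSqUV (ttpRho (cos kn) (cos ka)) (-1) (cos ka) = ipGradSq S π ka →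
      t ∈ Icc (talo : ℝ) tahi) ∧
    (1 + (δ : ℝ)) ^ 2 * (ttpGradSqUV (ttpRho (cos kn) (cos ka)) (cos kn) (cos kn) * ipGradSq S π ka) ≤
      ttpGradSqUV (ttpRho (cos kn) (cos ka)) (-1) (cos ka) * ipGradSq S kn kn := by
  have hA := ipAnti_of_kdCheck hm
  have hε := fermi_mem_Icc_of_ipBracketCheck hK hG hS hA hbr hν
  rw [ipGradSq_eq_UV, ipGradSq_eq_UV, cos_pi]
  set u := cos kn with hu_def
  set v := cos ka with hv_def
  have hn' : ipDiag S u = ε := by rw [← ipBandK_diag hS]; exact hn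
  have ha' : ipFace S v = ε := by rw [← ipBandK_face hS]; exact ha
  have hu := Ioo_subset_Icc_self (node_cos_mem_Ioo hA hnb hε ⟨neg_one_le_cos kn, cos_le_one kn⟩ hn')
  have hv := Ioo_subset_Icc_self (face_cos_mem_Ioo hA hfb hε ⟨neg_one_le_cos ka, cos_le_one ka⟩ ha')
  simp only [formSignCheck, Bool.and_eq_true, decide_eq_true_eq] at hsg
  obtain ⟨⟨⟨⟨⟨hη, htnlo⟩, htnhi⟩, htalo⟩, htahi⟩, hδ⟩ := hsg
  have c0 := eval_pt₂_le_of_kdCheck h0 hu hv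
  have c1 := eval_pt₂_le_of_kdCheck h1 hu hv
  have c2 := eval_pt₂_le_of_kdCheck h2 hu hv
  have c3 := eval_pt₂_le_of_kdCheck h3 hu hv
  have c4 := eval_pt₂_le_of_kdCheck h4 hu hv
  have c5 := eval_pt₂_le_of_kdCheck h5 hu hv
  have c6 := eval_pt₂_le_of_kdCheck h6 hu hv
  have c7 := eval_pt₂_le_of_kdCheck h7 hu hv
  simp only [fcRhoD, fcNodePos, fcFacePos, fcNodeLo, fcNodeHi, fcFaceLo, fcFaceHi, fcDefect,
    ArithExpr.eval_sub, ArithExpr.eval_mul, ArithExpr.eval_const, eval_rhoDE, eval_nodeFormNE,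
    eval_faceFormNE, eval_ipNodeGradSqE, eval_ipFaceGradSqE₁, pt₂_zero, pt₂_one, Rat.cast_pow, Rat.cast_add,
    Rat.cast_one, Rat.cast_zero] at c0 c1 c2 c3 c4 c5 c6 c7
  have hη' : (0 : ℝ) < η := by exact_mod_cast hη
  have hD : 0 < rhoD u v := by linarith
  have hDne : rhoD u v ≠ 0 := hD.ne'
  have hNf : 0 < nodeFormN u v := by linarith
  have hFf : 0 < faceFormN u v := by linarith
  have hGn : ttpGradSqUV (ttpRho u v) u u = nodeFormN u v / rhoD u v ^ 2 := by
    rw [← nodeFormN_eq hDne]; field_simp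
  have hGf : ttpGradSqUV (ttpRho u v) (-1) v = faceFormN u v / rhoD u v ^ 2 := by
    rw [← faceFormN_eq hDne]; field_simp
  have hD2 : 0 < rhoD u v ^ 2 := by positivity
  refine ⟨?_, ?_, ?_, ?_⟩
  · rw [← ttpUV_eq_oneBand, ← ttpUV_eq_oneBand, cos_pi]
    exact ttpRho_contour hDne
  · intro t ht hmatch
    rw [hGn] at hmatch
    have key : t ^ 2 * nodeFormN u v = rhoD u v ^ 2 * ipGradSqUV S u u := by
      rw [← hmatch]; field_simp
    have htnlo' : (0 : ℝ) ≤ tnlo := by exact_mod_cast htnlo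
    have htnhi' : (0 : ℝ) ≤ tnhi := by exact_mod_cast htnhi
    constructor
    · refine le_of_sq_le_sq' ?_ htnlo' ht
      exact le_of_mul_le_mul_right (by linarith) hNf
    · refine le_of_sq_le_sq' ?_ ht htnhi'
      exact le_of_mul_le_mul_right (by linarith) hNf
  · intro t ht hmatch
    rw [hGf] at hmatch
    have key : t ^ 2 * faceFormN u v = rhoD u v ^ 2 * ipGradSqUV S (-1) v := by
      rw [← hmatch]; field_simp
    have htalo' : (0 : ℝ) ≤ talo := by exact_mod_cast htalo
    have htahi' : (0 : ℝ) ≤ tahi := by exact_mod_cast htahi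
    constructor
    · refine le_of_sq_le_sq' ?_ htalo' ht
      exact le_of_mul_le_mul_right (by linarith) hFf
    · refine le_of_sq_le_sq' ?_ ht htahi'
      exact le_of_mul_le_mul_right (by linarith) hFf
  · rw [hGn, hGf]
    rw [show (1 + (δ : ℝ)) ^ 2 * (nodeFormN u v / rhoD u v ^ 2 * ipGradSqUV S (-1) v) =
        ((1 + (δ : ℝ)) ^ 2 * nodeFormN u v * ipGradSqUV S (-1) v) / rhoD u v ^ 2 by field_simp]
    rw [show faceFormN u v / rhoD u v ^ 2 * ipGradSqUV S u u = (faceFormN u v * ipGradSqUV S u u) / rhoD u v ^ 2 by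
        field_simp]
    exact div_le_div_of_nonneg_right (by linarith) hD2.le

end Summit.Ventures.CertifiedManyBodySolver.Downfold.Emery
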